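import Summits.QuantumFields.BalabanUV.T4Continuum.Support.NE7SquaredBumpNestedFix
import Summits.QuantumFields.BalabanUV.T4Continuum.Support.NE7SquaredBumpCovariantLaplacian
import Summits.QuantumFields.BalabanUV.T4Continuum.Support.NE3TopRadiusLetters
import Summits.QuantumFields.BalabanUV.T4Continuum.Support.NE3FluxGradientDictionary
import HarnessLib

/-!
# NE7SmoothRightInverseBmeanIterW — (T1♯) DISCHARGED FROM THE CLASS DATA: the squared-tent nested-mean fix `sfixW θ′` is an EXACT right inverse of `bmeanIterW L (j+1) W` at a curved
# background of the multi-level small-field class, skew, periodic, with sup `C_a = 2·64^d` and COVARIANT-LAPLACIAN sup `C_a′ = K_Δ·2·64^d = O((1 + d²b + d²M³x₁ + d³b²)∕M²)`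
# (file 117 of the curved (APE), F187; (T1♯) of F182∕F183 is a THEOREM)

Cell `pub-balaban`, rung (B)+1 sub-cell t4, lineage `b2b-balaban-t4-ne7-p1` (CRUX PROVER NE7 #1 = OWNER of row NE7), generation 84; memo `t4/b2b-balaban-t4-ne7-p1-g84/SCALAR-ROWS.md` §3.
Over F185 `NE7SquaredBumpNestedFix` (exactness, skewness, periodicity, sup), F186 `NE7SquaredBumpCovariantLaplacian.norm_covLapSite_dressW_bump2_le` (the `C¹` gain at the curved
background), row NE3's `NE3TopRadiusLetters.E_le_half_of_levelSmall` (the bridge smallness `E_j ≤ 1∕2` FROM `LevelSmall` ALONE) and `NE3FluxGradientDictionary` (`x₁ = 2g_W`) BY NAME.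
WHAT ([folklore]; 0 def, 0 sorry).  **`smoothRightInverse_letter`** (plaquette-gradient radius `x₁`) and **`smoothRightInverse_letter_of_fluxGrad`** (the END's flux-gradient radius `g_W`,
`x ≤ 1∕4`): literally the binder `hT` of F183 `NE7ApeCurvedRepRoadBSmoothInverseEnd` with
`C_a := 2·64^d`, `C_a′ := (35d∕M² + 2(2d²(M−1)x₁ + 8d³(M−1)²x²) + 4d((d−1)(M−1)x)² + 8d(d−1)(M−1)x∕M)·2·64^d`, `M = L^{j+1}`.
POWER COUNTING: with `x = b∕M²`, `x₁ = 2g_W ≍ c∕M³` every term of `C_a′` is `∝ 1∕M²`, so F182's `C_H = C_a + C_b·C_a′` with F180's `C_b = 36d(frameC+d)²M²c_RE` is k-UNIFORM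
(volume-dependent through `c_RE`, the END's own currency).
HONEST FRAMING (page 1): approximation theory over landed kinematics at one background of the class; nothing of Bałaban's asserted; (KL-B), (APE) on curved data NOT proved; NOT ONE-STEP,
NOT NE7; spine 0∕9; finite T⁴ rung (B)+1 — NOT infinite volume, NOT mass gap, NOT `BetaPertH`, NOT Clay.  Continuum YM on T⁴ ⇐ BetaPertH ∧ nine spine estimates (0/9 proved);
BetaPertH ⇐ (D1) ∧ (D4) ∧ CAP+tail; G-an2-4 gates asym, D1 and NE2/3/4.
-/

set_option autoImplicit false

open scoped BigOperators Matrix Matrix.Norms.L2Operator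
open NormedSpace Finset

namespace Summit.QuantumFields.BalabanUV.T4Continuum.NE7SmoothRightInverseBmeanIterW

open Literature.MathematicalPhysics.QuantumFieldTheory.Balaban1983to89
open B7Prop1Explicit B7Prop2Explicit
open T4AveragingDeficitWall (Ad IsUnitaryCfg SmallField covGrad flux Plane)
open T4AveragingDeficitWallBoundary (IsPeriodicCfg)
open AveragingDeficitMultiLevelPrep (tower LevelSmall)
open NE3CovariantBlockMean (bmeanIterW)
open NE3CurvedProjectedLandau (tower_eq_pow_mul)
open NE3.PairLandauB8 (covLapSite)
open NE3TopRadiusLetters (E_le_half_of_levelSmall)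
open NE3FluxGradientDictionary (norm_Ad_hol_sub_hol_le_of_fluxGrad)
open NE7SquaredBumpNestedFix (sfixCoef sfixW bmeanIterW_sfixW_eq sfixW_mem_skewAdjoint sfixW_add_period norm_sfixW_le_of_sup norm_sfixCoef_le_of_sup)
open NE7SquaredBumpCovariantLaplacian (norm_covLapSite_dressW_bump2_le)

noncomputable section

variable {d : ℕ} {n : Type*} [Fintype n] [DecidableEq n]

/-- **(T1♯) FROM THE CLASS DATA AND THE PLAQUETTE-GRADIENT RADIUS** (`d ≥ 1`, `L ≥ 2`, `N ≥ 1`, `j`; `M = L^{j+1}`): for unitary `(N·M)`-periodic `W` with `LevelSmall d L j x`,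
`SmallField W x` and covariant plaquette gradients `≤ x₁`, every skew `N`-periodic coarse `θ′` with `‖θ′‖_∞ ≤ s` has the skew `(N·M)`-periodic EXACT extension `h₀ = sfixW θ′`:
`bmeanIterW L (j+1) W h₀ = θ′`, `‖h₀‖_∞ ≤ 2·64^d·s`, `‖Δ_W h₀‖_∞ ≤ K_Δ·2·64^d·s`. [folklore] -/
theorem smoothRightInverse_letter [Nonempty n] (hd : 1 ≤ d) {L N : ℕ} [NeZero N] (hL : 2 ≤ L) (j : ℕ)
    {W : Site d → Fin d → (Matrix n n ℂ)ˣ} {x x₁ : ℝ} (hWu : IsUnitaryCfg W) (hWP : IsPeriodicCfg W ((N * L ^ (j + 1) : ℕ) : ℤ))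
    (hx : 0 ≤ x) (hs : LevelSmall d L j x) (hWx : SmallField W x) (hx10 : 0 ≤ x₁)
    (hgrad : ∀ (p : Site d) (μ κ : Fin d), κ ≠ μ →
      ‖Ad (W p μ) ((hol W (p + e μ) (plaqWord κ μ) : (Matrix n n ℂ)ˣ) : Matrix n n ℂ) - ((hol W p (plaqWord κ μ) : (Matrix n n ℂ)ˣ) : Matrix n n ℂ)‖ ≤ x₁) :
    ∀ θ' : Site d → Matrix n n ℂ, (∀ z, θ' z ∈ skewAdjoint (Matrix n n ℂ)) → (∀ (z : Site d) (i : Fin d), θ' (z + (N : ℤ) • e i) = θ' z) →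
      ∀ s : ℝ, (∀ z, ‖θ' z‖ ≤ s) →
      ∃ h₀ : Site d → Matrix n n ℂ, (∀ y, h₀ y ∈ skewAdjoint (Matrix n n ℂ)) ∧
        (∀ (y : Site d) (i : Fin d), h₀ (y + ((N * L ^ (j + 1) : ℕ) : ℤ) • e i) = h₀ y) ∧
        bmeanIterW L (j + 1) W h₀ = θ' ∧ (∀ y, ‖h₀ y‖ ≤ (2 * (64 : ℝ) ^ d) * s) ∧
        (∀ y, ‖covLapSite W h₀ y‖
          ≤ ((35 * (d : ℝ) / ((L : ℝ) ^ (j + 1)) ^ 2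
              + 2 * (2 * (d : ℝ) ^ 2 * ((L : ℝ) ^ (j + 1) - 1) * x₁ + 8 * (d : ℝ) ^ 3 * ((L : ℝ) ^ (j + 1) - 1) ^ 2 * x ^ 2)
              + 4 * (d : ℝ) * (((d : ℝ) - 1) * ((L : ℝ) ^ (j + 1) - 1) * x) ^ 2
              + 8 * (d : ℝ) * (((d : ℝ) - 1) * ((L : ℝ) ^ (j + 1) - 1) * x) / (L : ℝ) ^ (j + 1)) * (2 * (64 : ℝ) ^ d)) * s) := by
  intro θ' hθs hθP s hθb
  have hL1 : 1 ≤ L := by omega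
  have hM2 : 2 ≤ L ^ (j + 1) := Nat.le_trans hL (Nat.le_self_pow (Nat.succ_ne_zero j) L)
  have hMr : ((L ^ (j + 1) : ℕ) : ℝ) = (L : ℝ) ^ (j + 1) := by push_cast; ring
  have hE := E_le_half_of_levelSmall (d := d) hL1 j hx hs
  have htow : (tower L N (j + 1) : ℕ) = N * L ^ (j + 1) := by rw [tower_eq_pow_mul, Nat.mul_comm]
  have hWP' : IsPeriodicCfg W ((tower L N (j + 1) : ℕ) : ℤ) := by rw [htow]; exact hWP
  refine ⟨sfixW hL j hWu hx hs hWx hE θ', sfixW_mem_skewAdjoint hL j hWu hx hs hWx hE hθs, fun y i => ?_,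
    bmeanIterW_sfixW_eq hL j hWu hx hs hWx hE θ', fun y => (norm_sfixW_le_of_sup hL j hWu hx hs hWx hE θ' hθb y).2, fun y => ?_⟩
  · have h := sfixW_add_period hL j hWu hx hs hWx hE hWP' hθP y i
    rwa [htow] at h
  · have h := norm_covLapSite_dressW_bump2_le hd hM2 hWu hx hx10 hWx hgrad (sfixCoef hL j hWu hx hs hWx hE θ')
      (norm_sfixCoef_le_of_sup hL j hWu hx hs hWx hE θ' hθb) y
    rw [hMr] at h
    refine (le_of_eq rfl).trans (h.trans (le_of_eq ?_))
    ring

/-- **(T1♯) FROM THE END's CLASS DATA** (`d ≥ 1`, `L ≥ 2`, `N ≥ 1`, `j`): the same with the flux-gradient radius `‖covGrad W (flux W)‖ ≤ g_W` and `x ≤ 1∕4` (`x₁ = 2g_W` by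
`NE3FluxGradientDictionary`). [folklore] -/
theorem smoothRightInverse_letter_of_fluxGrad [Nonempty n] (hd : 1 ≤ d) {L N : ℕ} [NeZero N] (hL : 2 ≤ L) (j : ℕ)
    {W : Site d → Fin d → (Matrix n n ℂ)ˣ} {x gW : ℝ} (hWu : IsUnitaryCfg W) (hWP : IsPeriodicCfg W ((N * L ^ (j + 1) : ℕ) : ℤ))
    (hx : 0 ≤ x) (hx4 : x ≤ 1 / 4) (hs : LevelSmall d L j x) (hWx : SmallField W x) (hgW0 : 0 ≤ gW)
    (hgW : ∀ (z : Site d) (μ : Fin d) (π : Plane d), ‖covGrad W (flux W) z μ π‖ ≤ gW) :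
    ∀ θ' : Site d → Matrix n n ℂ, (∀ z, θ' z ∈ skewAdjoint (Matrix n n ℂ)) → (∀ (z : Site d) (i : Fin d), θ' (z + (N : ℤ) • e i) = θ' z) →
      ∀ s : ℝ, (∀ z, ‖θ' z‖ ≤ s) →
      ∃ h₀ : Site d → Matrix n n ℂ, (∀ y, h₀ y ∈ skewAdjoint (Matrix n n ℂ)) ∧
        (∀ (y : Site d) (i : Fin d), h₀ (y + ((N * L ^ (j + 1) : ℕ) : ℤ) • e i) = h₀ y) ∧
        bmeanIterW L (j + 1) W h₀ = θ' ∧ (∀ y, ‖h₀ y‖ ≤ (2 * (64 : ℝ) ^ d) * s) ∧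
        (∀ y, ‖covLapSite W h₀ y‖
          ≤ ((35 * (d : ℝ) / ((L : ℝ) ^ (j + 1)) ^ 2
              + 2 * (2 * (d : ℝ) ^ 2 * ((L : ℝ) ^ (j + 1) - 1) * (2 * gW) + 8 * (d : ℝ) ^ 3 * ((L : ℝ) ^ (j + 1) - 1) ^ 2 * x ^ 2)
              + 4 * (d : ℝ) * (((d : ℝ) - 1) * ((L : ℝ) ^ (j + 1) - 1) * x) ^ 2
              + 8 * (d : ℝ) * (((d : ℝ) - 1) * ((L : ℝ) ^ (j + 1) - 1) * x) / (L : ℝ) ^ (j + 1)) * (2 * (64 : ℝ) ^ d)) * s) := by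
  have hgrad : ∀ (p : Site d) (μ κ : Fin d), κ ≠ μ →
      ‖Ad (W p μ) ((hol W (p + e μ) (plaqWord κ μ) : (Matrix n n ℂ)ˣ) : Matrix n n ℂ) - ((hol W p (plaqWord κ μ) : (Matrix n n ℂ)ˣ) : Matrix n n ℂ)‖ ≤ 2 * gW :=
    fun p μ κ hκμ => norm_Ad_hol_sub_hol_le_of_fluxGrad hWu hWx hx4 hgW p μ hκμ
  exact smoothRightInverse_letter hd hL j hWu hWP hx hs hWx (by positivity) hgrad

end

end Summit.QuantumFields.BalabanUV.T4Continuum.NE7SmoothRightInverseBmeanIterW
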